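import Literature.IUT.HodgeTheaters.Cor53InjectiveOfMonoidRigidity
import Literature.IUT.HodgeTheaters.InitialThetaDataBadLocalFrobenioidTempered
import Literature.AnabelianGeometry.SemiGraphs.CosetCategoriesSlimTempered
import HarnessLib

/-!
# [IUTchI] Cor 5.3 (ii) AT THE BAD COMPONENT `𝒞_v̲` (`v̲ ∈ V̲^bad`) OF AN `ℱ`-PRIME-STRIP: «`Aut(𝒞_v̲) → Aut(𝒟_v̲)` bijective»
# modulo print's two halves, the carrier being the base-field-theoretic hull of a tempered Frobenioid (proof-only)

S. Mochizuki, *Inter-universal Teichmüller theory I*, kurims manuscript (May 2020), §5 Corollary 5.3 (ii) p. 144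
l. 14–18 («For `i = 1, 2`, let `ⁱ𝔉` be an `ℱ`-prime-strip; `ⁱ𝔇` the `𝒟`-prime-strip associated to `ⁱ𝔉`. Then the
natural map `Isom(¹𝔉, ²𝔉) → Isom(¹𝔇, ²𝔇)` is bijective»), proof p. 144 l. 33–36 («Assertion (ii) … follows
immediately from [AbsTopIII], Proposition 3.2, (iv); [AbsTopIII], Proposition 4.2, (i) [cf. also [AbsTopIII], Remarks
3.1.1, 4.1.1; the discussion of Definition 5.2, (vi), (viii)]») and the kernel-form argument printed for (iv), p. 144
l. 37–43 («since automorphisms of `𝒟_v = ℬ^temp(X̲̲_v)⁰` necessarily arise from automorphisms of the scheme `X̲̲_v` …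
surjectivity follows … it remains to verify injectivity … let `α ∈ Ker` … lies over the identity … `α` is [isomorphic
to] the identity»; line numbers on this seat's own render); Definition 5.2 (i) p. 141 (at
`v̲ ∈ V̲^non` the datum `‡ℱ_v̲` of an `ℱ`-prime-strip is «a category `‡𝒞_v̲` equivalent to `𝒞_v̲`» of Examples 3.2 (iii)
[bad] / 3.3 (i) [good]); Example 3.2 (iii) p. 71 l. 13–18: «the `p_v`-adic Frobenioid constituted by the
"base-field-theoretic hull" `𝒞_v ⊆ ℱ̲_v` [i.e., we write `𝒞_v` for the subcategory "`𝒞^{bs-fld}`" of [EtTh],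
Definition 3.6, (iv)]» ([IUTchI] Cor 5.3 (ii) p.144) [claim: Mochizuki2012, status: disputed] (D-0012 claim key;
nothing of the series is asserted; no side taken on [IUTchIII] Cor. 3.12).  S. Mochizuki, *The étale theta function
…* [EtTh], Def 3.6 (iv) p. 78: «the data `(D, Φ^{bs-fld}, F, F → (Φ^{bs-fld})^gp)` determines a model Frobenioid
`𝒞^{bs-fld}`» [cite: MochizukiEtTh2009, Def 3.6 p.78] — in the tree abc-iut-L2's
`TemperedFrobenioid.hullCategory Fr = ModelFrobenioid Fr.bsFldMonoid Fr.cnstFnBsFunctor Fr.divFNatTrans` over `D`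
(`TemperedFrobenioidHull.lean`), with structure functor `Fr.hull ⋙ Fr.baseFunctorOfCategory =
ModelFrobenioid.baseFunctor …` (`TemperedFrobenioid.hull_comp_baseFunctor`, `rfl`).

PROOF-ONLY (theorems only; L5 ROWS #7 R53 «COR53II-BAD-COMPONENT»; typer of record of the Cor 5.3 hub abc-iut-L5-t4).
This is the BAD-PLACE companion of abc-iut-L5-t4's T5 `Cor53iiAtGoodPlace.lean` (p495336), in the SAME `hker/hlift`
shape: by `FKit.isomFtoDBijective_iff_model` (p409092) / `CatIsomorphism.mapIso_kindFunctor_bijective_iff` (p492186)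
the token `IUTchI:Cor5.3(ii)` is, place by place, the MODEL CASE «the natural map `Aut(𝒞_v̲) → Aut(𝒟_v̲)` of §0 is
bijective» = `CatIsomorphism.DescendBijective`; at a bad place the carrier `𝒞_v̲` is an L1 MODEL Frobenioid (the hull),
so the §0 natural map's binders `he`/`hu` are DISCHARGED by abc-iut-L5-t4's `Cor53.hasUnder_baseFunctor_model` /
`Cor53.underUnique_baseFunctor_model` (p493191; [FrdI] Cor 4.11 (ii)/(iv) at the model, abc-iut-L1-t14) modulo the
[FrdI] standing hypotheses BY NAME on the HULL's data (`ModelFrobenioid.Hypotheses`, `Φ^{bs-fld}` perf-factorial,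
non-dilating, non-zero; `D` slim of FSMFF-type), and print's two halves are DISPLAYED inputs:
* INJECTIVITY input `hker` — «every self-equivalence of `𝒞_v̲` lying over the identity of `𝒟_v̲` is isomorphic to the
  identity» (print p. 144 l. 40–43; in the tree the conclusion shape of abc-iut-L1-t7's [FrdI] rigidity chain
  S2/S2′ — `ModelFrobenioid.selfEquivalence_iso_id_of_over_base` p491743 and its unit-ratio successors p497859 → —
  read at the hull; NOT the gauge-fixed `hmon` shape, which abc-iut-L1-d3's
  `PadicFrd.Datum.not_forall_selfEquivalence_over_id_hdiv_hunit` shows vacuous as a law at `p`-adic Frobenioids);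
* SURJECTIVITY input `hlift` — «every self-equivalence of `𝒟_v̲` lifts to `𝒞_v̲`» (the surjectivity half of print's
  proof of (ii), p. 144 l. 33–36 «[AbsTopIII], Proposition 3.2, (iv)», and — the base being `𝒟_v̲ = ℬ^temp(X̲̲_v̲)⁰` —
  l. 37–39 «automorphisms of `𝒟_v` necessarily arise from automorphisms of the scheme `X̲̲_v` [cf. [AbsTopIII],
  Theorem 1.9; Remark 1.9.1]»; FACT-policy, BY NAME — schema F-0409 `GaloisIsoLiftsToTMPairIso` as in T5).
§1 at EVERY [EtTh] Def 3.6 tempered Frobenioid `Fr` over any base `D`; §2 over the REAL bad-place base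
`𝒟_v = CosetCat Π_v` of a bad-place group datum (abc-iut-L5-t2's `BadLocalFrobenioid.ofKits … R.toInput`, whose `C_v` IS
`Fr.hullCategory` and whose `C_v → ℱ̲_v → 𝒟_v` IS the hull's base functor — `rfl`), slimness of `CosetCat Π_v` from
`Π_v` TEMPERED and SLIM (abc-iut-L3/L1 `CosetCat.isSlim_of_isSlimGroup_of_isTempered`, [SemiAnbd] Rmk 3.4.1) and
FSMFF-type DISCHARGED (`CosetCat.isOfFSMType`); §3 at the GENUINE bad datum of the initial Θ-data
`D.badLocalFrobenioidAtDoubleUnderline hv w p hw dGL hS2 C ι R.toInput` (`Π_v̲ := Π^tp_{X̲̲}` of the [EtTh] §1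
double-underline curve; temperedness/slimness are THEOREMS `BadLocalGroupDatum.isTempered_Huu` / `isSlimGroup_Huu`),
so the headline keeps ONLY the four [FrdI] standing hypotheses on the hull's monoid + {hker, hlift}.
Binder census of the headline (§3): LAW 0 · inputs {hker, hlift (FACT)} · by-name standing hypotheses 4 (`h`, `hpf`,
`hnd`, `hz` on `Φ^{bs-fld}`) · DATA {D, v̲ = w, p, (S, dGL, hS2, ES, C, ι), Fr, R}.  Typed ≠ proved for hker/hlift; no
token flip is claimed by this file alone; nothing asserts that an [EtTh] tempered Frobenioid arises from an actual
Tate curve.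
-/

noncomputable section

namespace Literature.IUT.HodgeTheaters

open CategoryTheory Opposite Literature.AlgebraicGeometry.Frobenioids Literature.AnabelianGeometry.SemiGraphs
open Literature.AnabelianGeometry.EtaleTheta Literature.AlgebraicGeometry.Frobenioids.PadicFrd

universe u₀ v₀ u v w

namespace Cor53

/-! ### §1. At the base-field-theoretic hull `𝒞 = Fr^{bs-fld}` of EVERY [EtTh] Def 3.6 tempered Frobenioid `Fr` over `D` -/

section Hull

variable {D₀ : Type u₀} [Category.{v₀} D₀] {V : FrdIMonoidStub.{w}}
  {T : RealifiedDivisorMonoids (D₀ := D₀) V} {D : Type u} [Category.{v} D]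
  {VD : FrdICatStub.{u, v, w} D} (Fr : TemperedFrobenioid T D VD)

/-- **Cor 5.3 (ii) model case, INJECTIVITY, at the bad component `𝒞_v̲ = Fr^{bs-fld}`** of every [EtTh] Def 3.6
tempered Frobenioid `Fr` over `D`: the §0 natural map `Aut(𝒞_v̲) → Aut(𝒟_v̲)` — `CatIsomorphism.descend` for the
hull's base functor, binders `he`/`hu` DISCHARGED by abc-iut-L5-t4's `hasUnder_baseFunctor_model` /
`underUnique_baseFunctor_model` under the [FrdI] standing hypotheses BY NAME on the hull — is INJECTIVE as soon as
every self-equivalence of `𝒞_v̲` lying over the identity of `𝒟_v̲` is isomorphic to the identity (print p. 144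
l. 40–43). ([IUTchI] Cor 5.3 (ii) p.144) [claim: Mochizuki2012, status: disputed] -/
theorem hull_descend_injective_of_kernel_trivial
    (h : ModelFrobenioid.Hypotheses Fr.bsFldMonoid Fr.cnstFnBsFunctor)
    (hpf : Objectwise (fun M _ => IsPerfFactorial M) Fr.bsFldMonoid) (hsl : IsSlim D) (hfs : IsOfFSMFFType D)
    (hnd : IsNonDilatingOn Fr.bsFldMonoid) (hz : ¬ ModelFrobenioid.IsZeroMonoid Fr.bsFldMonoid)
    (hker : ∀ Ψ : Fr.hullCategory ≌ Fr.hullCategory,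
      Nonempty (CatIsomorphism.LiesUnder
        (ModelFrobenioid.baseFunctor Fr.bsFldMonoid Fr.cnstFnBsFunctor Fr.divFNatTrans)
        (ModelFrobenioid.baseFunctor Fr.bsFldMonoid Fr.cnstFnBsFunctor Fr.divFNatTrans)
        Ψ (CategoryTheory.Equivalence.refl (C := D))) →
      Nonempty (Ψ.functor ≅ 𝟭 Fr.hullCategory)) :
    Function.Injective
      (CatIsomorphism.descend
        (Cor53.hasUnder_baseFunctor_model (DivB := Fr.divFNatTrans) h hpf hsl hfs hnd hz)
        (Cor53.underUnique_baseFunctor_model (DivB := Fr.divFNatTrans) h hpf hsl hfs hnd hz)) :=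
  CatIsomorphism.descend_injective_of_kernel_trivial _ _ hker

/-- **Cor 5.3 (ii) model case AS PRINTED («bijective») at the bad component `𝒞_v̲ = Fr^{bs-fld}`** of every [EtTh]
Def 3.6 tempered Frobenioid, from print's two halves: kernel triviality `hker` (injectivity) and lifting `hlift`
(surjectivity: print p. 144 l. 33–39, [AbsTopIII] Prop 3.2 (iv) / Thm 1.9 at `𝒟_v = ℬ^temp(X̲̲_v)⁰` —
FACT-policy, BY NAME), modulo the [FrdI] standing hypotheses on the hull BY NAME: `CatIsomorphism.DescendBijective`
holds for the hull's base functor with DISCHARGED binders. ([IUTchI] Cor 5.3 (ii) p.144) [claim: Mochizuki2012, status: disputed] -/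
theorem hull_descendBijective_of_kernel_trivial_of_lifts
    (h : ModelFrobenioid.Hypotheses Fr.bsFldMonoid Fr.cnstFnBsFunctor)
    (hpf : Objectwise (fun M _ => IsPerfFactorial M) Fr.bsFldMonoid) (hsl : IsSlim D) (hfs : IsOfFSMFFType D)
    (hnd : IsNonDilatingOn Fr.bsFldMonoid) (hz : ¬ ModelFrobenioid.IsZeroMonoid Fr.bsFldMonoid)
    (hker : ∀ Ψ : Fr.hullCategory ≌ Fr.hullCategory,
      Nonempty (CatIsomorphism.LiesUnder
        (ModelFrobenioid.baseFunctor Fr.bsFldMonoid Fr.cnstFnBsFunctor Fr.divFNatTrans)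
        (ModelFrobenioid.baseFunctor Fr.bsFldMonoid Fr.cnstFnBsFunctor Fr.divFNatTrans)
        Ψ (CategoryTheory.Equivalence.refl (C := D))) →
      Nonempty (Ψ.functor ≅ 𝟭 Fr.hullCategory))
    (hlift : ∀ Θ : D ≌ D, ∃ Ψ : Fr.hullCategory ≌ Fr.hullCategory,
      Nonempty (CatIsomorphism.LiesUnder
        (ModelFrobenioid.baseFunctor Fr.bsFldMonoid Fr.cnstFnBsFunctor Fr.divFNatTrans)
        (ModelFrobenioid.baseFunctor Fr.bsFldMonoid Fr.cnstFnBsFunctor Fr.divFNatTrans) Ψ Θ)) :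
    CatIsomorphism.DescendBijective
      (ModelFrobenioid.baseFunctor Fr.bsFldMonoid Fr.cnstFnBsFunctor Fr.divFNatTrans)
      (ModelFrobenioid.baseFunctor Fr.bsFldMonoid Fr.cnstFnBsFunctor Fr.divFNatTrans)
      (Cor53.hasUnder_baseFunctor_model (DivB := Fr.divFNatTrans) h hpf hsl hfs hnd hz)
      (Cor53.underUnique_baseFunctor_model (DivB := Fr.divFNatTrans) h hpf hsl hfs hnd hz) :=
  ⟨hull_descend_injective_of_kernel_trivial Fr h hpf hsl hfs hnd hz hker,
    CatIsomorphism.descend_surjective_of_lifts _ _ hlift⟩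

/-- The same in «natural homomorphism» form: `CatIsomorphism.descendHom : Aut(𝒞_v̲) →* Aut(𝒟_v̲)` is injective
modulo `hker` and the standing hypotheses on the hull. ([IUTchI] Cor 5.3 (ii) p.144) [claim: Mochizuki2012, status: disputed] -/
theorem hull_descendHom_injective_of_kernel_trivial
    (h : ModelFrobenioid.Hypotheses Fr.bsFldMonoid Fr.cnstFnBsFunctor)
    (hpf : Objectwise (fun M _ => IsPerfFactorial M) Fr.bsFldMonoid) (hsl : IsSlim D) (hfs : IsOfFSMFFType D)
    (hnd : IsNonDilatingOn Fr.bsFldMonoid) (hz : ¬ ModelFrobenioid.IsZeroMonoid Fr.bsFldMonoid)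
    (hker : ∀ Ψ : Fr.hullCategory ≌ Fr.hullCategory,
      Nonempty (CatIsomorphism.LiesUnder
        (ModelFrobenioid.baseFunctor Fr.bsFldMonoid Fr.cnstFnBsFunctor Fr.divFNatTrans)
        (ModelFrobenioid.baseFunctor Fr.bsFldMonoid Fr.cnstFnBsFunctor Fr.divFNatTrans)
        Ψ (CategoryTheory.Equivalence.refl (C := D))) →
      Nonempty (Ψ.functor ≅ 𝟭 Fr.hullCategory)) :
    Function.Injective
      (CatIsomorphism.descendHom
        (Cor53.hasUnder_baseFunctor_model (DivB := Fr.divFNatTrans) h hpf hsl hfs hnd hz)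
        (Cor53.underUnique_baseFunctor_model (DivB := Fr.divFNatTrans) h hpf hsl hfs hnd hz)) :=
  hull_descend_injective_of_kernel_trivial Fr h hpf hsl hfs hnd hz hker

end Hull

/-! ### §2. Over the REAL bad-place base `𝒟_v = CosetCat Π_v` of a bad-place group datum ([IUTchI] Ex 3.2 with
`ℱ̲_v := Fr.category`, `𝒞_v := Fr^{bs-fld}`: abc-iut-L5-t2's `BadLocalFrobenioid.ofKits … R.toInput`) -/

section RealBase

variable {p : ℕ} [Fact p.Prime] (l : ℕ) (d : GaloisValDatum.{0} p) {P : Type} [Group P]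
  [TopologicalSpace P] [IsTopologicalGroup P] (T : BadLocalGroupDatum d.Gal P) (q qroot : intNonzero d.k)
  (hpow : qroot ^ (2 * l) = q) (hq : ¬ IsUnit qroot) {D₀ : Type u₀} [Category.{v₀} D₀]
  {V : FrdIMonoidStub.{0}} {T' : RealifiedDivisorMonoids (D₀ := D₀) V} {VD : FrdICatStub.{0, 0, 0} T.Dv}
  (Fr : TemperedFrobenioid T' T.Dv VD) {Fbirat : Type} [Category.{0} Fbirat] (R : TemperedThetaRest d T hq Fr Fbirat)

omit [IsTopologicalGroup P] in
/-- Bookkeeping at the assembly: the bad component `C_v` of `ofKits … R.toInput` IS the hull `Fr^{bs-fld}`, and its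
structure functor `C_v → ℱ̲_v → 𝒟_v` IS the hull's base functor (both `rfl`). ([IUTchI] Ex 3.2 (iii) p.71) [claim: Mochizuki2012, status: disputed] -/
theorem ofKits_toInput_Cv_structureFunctor :
    (BadLocalFrobenioid.ofKits l d T q qroot hpow hq R.toInput).Cv = Fr.hullCategory ∧
      (BadLocalFrobenioid.ofKits l d T q qroot hpow hq R.toInput).hull ⋙
          (BadLocalFrobenioid.ofKits l d T q qroot hpow hq R.toInput).toBase =
        ModelFrobenioid.baseFunctor Fr.bsFldMonoid Fr.cnstFnBsFunctor Fr.divFNatTrans :=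
  ⟨rfl, rfl⟩

/-- `𝒟_v = CosetCat Π_v` is SLIM for `Π_v` tempered and slim ([SemiAnbd] Ex 3.10 / Rmk 3.4.1; abc-iut-L3/L1
`CosetCat.isSlim_of_isSlimGroup_of_isTempered`) and of FSMFF-type ([FrdII] Ex 1.3 (i); `CosetCat.isOfFSMType`).
[cite: MochizukiSemiAnbd2006, Ex 3.10 p.43] -/
theorem isSlim_and_isOfFSMFFType_Dv (hG : IsTempered P) (hZ : IsSlimGroup P) :
    IsSlim T.Dv ∧ IsOfFSMFFType T.Dv :=
  ⟨CosetCat.isSlim_of_isSlimGroup_of_isTempered hG hZ, (CosetCat.isOfFSMType (G := P)).isOfFSMFFType⟩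

/-- **Cor 5.3 (ii) model case AS PRINTED at the bad component `C_v = Fr^{bs-fld}` over the REAL base
`𝒟_v = CosetCat Π_v`** (`Π_v` tempered and slim): `Aut(C_v) → Aut(𝒟_v)` is BIJECTIVE — `CatIsomorphism.DescendBijective`
with DISCHARGED binders — modulo the four [FrdI] standing hypotheses on `Φ^{bs-fld}` BY NAME + kernel triviality
`hker` + lifting `hlift`; slimness and FSMFF-type of the base are THEOREMS here.
([IUTchI] Cor 5.3 (ii) p.144) [claim: Mochizuki2012, status: disputed] -/
theorem cosetCat_hull_descendBijective_of_kernel_trivial_of_lifts (hG : IsTempered P) (hZ : IsSlimGroup P)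
    (h : ModelFrobenioid.Hypotheses Fr.bsFldMonoid Fr.cnstFnBsFunctor)
    (hpf : Objectwise (fun M _ => IsPerfFactorial M) Fr.bsFldMonoid)
    (hnd : IsNonDilatingOn Fr.bsFldMonoid) (hz : ¬ ModelFrobenioid.IsZeroMonoid Fr.bsFldMonoid)
    (hker : ∀ Ψ : Fr.hullCategory ≌ Fr.hullCategory,
      Nonempty (CatIsomorphism.LiesUnder
        (ModelFrobenioid.baseFunctor Fr.bsFldMonoid Fr.cnstFnBsFunctor Fr.divFNatTrans)
        (ModelFrobenioid.baseFunctor Fr.bsFldMonoid Fr.cnstFnBsFunctor Fr.divFNatTrans)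
        Ψ (CategoryTheory.Equivalence.refl (C := T.Dv))) →
      Nonempty (Ψ.functor ≅ 𝟭 Fr.hullCategory))
    (hlift : ∀ Θ : T.Dv ≌ T.Dv, ∃ Ψ : Fr.hullCategory ≌ Fr.hullCategory,
      Nonempty (CatIsomorphism.LiesUnder
        (ModelFrobenioid.baseFunctor Fr.bsFldMonoid Fr.cnstFnBsFunctor Fr.divFNatTrans)
        (ModelFrobenioid.baseFunctor Fr.bsFldMonoid Fr.cnstFnBsFunctor Fr.divFNatTrans) Ψ Θ)) :
    CatIsomorphism.DescendBijective
      (ModelFrobenioid.baseFunctor Fr.bsFldMonoid Fr.cnstFnBsFunctor Fr.divFNatTrans)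
      (ModelFrobenioid.baseFunctor Fr.bsFldMonoid Fr.cnstFnBsFunctor Fr.divFNatTrans)
      (Cor53.hasUnder_baseFunctor_model (DivB := Fr.divFNatTrans) h hpf
        (CosetCat.isSlim_of_isSlimGroup_of_isTempered hG hZ) (CosetCat.isOfFSMType (G := P)).isOfFSMFFType hnd hz)
      (Cor53.underUnique_baseFunctor_model (DivB := Fr.divFNatTrans) h hpf
        (CosetCat.isSlim_of_isSlimGroup_of_isTempered hG hZ) (CosetCat.isOfFSMType (G := P)).isOfFSMFFType hnd hz) :=
  hull_descendBijective_of_kernel_trivial_of_lifts Fr h hpf (CosetCat.isSlim_of_isSlimGroup_of_isTempered hG hZ)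
    (CosetCat.isOfFSMType (G := P)).isOfFSMFFType hnd hz hker hlift

/-- Injectivity half alone over the REAL base (what the rigidity rows deliver at the hull).
([IUTchI] Cor 5.3 (ii) p.144) [claim: Mochizuki2012, status: disputed] -/
theorem cosetCat_hull_descend_injective_of_kernel_trivial (hG : IsTempered P) (hZ : IsSlimGroup P)
    (h : ModelFrobenioid.Hypotheses Fr.bsFldMonoid Fr.cnstFnBsFunctor)
    (hpf : Objectwise (fun M _ => IsPerfFactorial M) Fr.bsFldMonoid)
    (hnd : IsNonDilatingOn Fr.bsFldMonoid) (hz : ¬ ModelFrobenioid.IsZeroMonoid Fr.bsFldMonoid)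
    (hker : ∀ Ψ : Fr.hullCategory ≌ Fr.hullCategory,
      Nonempty (CatIsomorphism.LiesUnder
        (ModelFrobenioid.baseFunctor Fr.bsFldMonoid Fr.cnstFnBsFunctor Fr.divFNatTrans)
        (ModelFrobenioid.baseFunctor Fr.bsFldMonoid Fr.cnstFnBsFunctor Fr.divFNatTrans)
        Ψ (CategoryTheory.Equivalence.refl (C := T.Dv))) →
      Nonempty (Ψ.functor ≅ 𝟭 Fr.hullCategory)) :
    Function.Injective
      (CatIsomorphism.descend
        (Cor53.hasUnder_baseFunctor_model (DivB := Fr.divFNatTrans) h hpf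
          (CosetCat.isSlim_of_isSlimGroup_of_isTempered hG hZ) (CosetCat.isOfFSMType (G := P)).isOfFSMFFType hnd hz)
        (Cor53.underUnique_baseFunctor_model (DivB := Fr.divFNatTrans) h hpf
          (CosetCat.isSlim_of_isSlimGroup_of_isTempered hG hZ) (CosetCat.isOfFSMType (G := P)).isOfFSMFFType hnd hz)) :=
  hull_descend_injective_of_kernel_trivial Fr h hpf (CosetCat.isSlim_of_isSlimGroup_of_isTempered hG hZ)
    (CosetCat.isOfFSMType (G := P)).isOfFSMFFType hnd hz hker

end RealBase

/-! ### §3. At the GENUINE bad datum of the initial Θ-data: `Π_v̲ := Π^tp_{X̲̲}` of the [EtTh] §1 double-underline curve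
(abc-iut-L5-t2's `D.badLocalFrobenioidAtDoubleUnderline hv w p hw dGL hS2 C ι R.toInput`) -/

section GenuineBadPlace

open NumberField IsDedekindDomain

variable {F K Fbar : Type} [Field F] [NumberField F] [Field K] [NumberField K] [Algebra F K]
  [Field Fbar] [Algebra F Fbar] [Algebra K Fbar] [IsScalarTower F K Fbar] {E : WeierstrassCurve F}
  [E.IsElliptic] {l : ℕ} {Pb : BadPlacePredicates K} (D : InitialThetaData F K Fbar E l Pb)
  {v : FinitePlace F} (hv : v ∈ D.VFbad) (w : HeightOneSpectrum (𝓞 K)) [w.asIdeal.LiesOver v.maximalIdeal.asIdeal]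
  (p : ℕ) [Fact p.Prime] (hw : ((p : ℕ) : 𝓞 K) ∈ w.asIdeal)
  {S : ThetaSetting p} {ES : S.EtaleThetaData} (dGL : S.toTemperedCurve.GroupLevelData) (hS2 : S.Sec2Hyps)
  (C : ES.DoubleUnderline l) (ι : ↥S.GK ≃ₜ* (GaloisValDatum.ofPlace K p w hw).Gal)
  {D₀ : Type u₀} [Category.{v₀} D₀] {V : FrdIMonoidStub.{0}} {T' : RealifiedDivisorMonoids (D₀ := D₀) V}
  {VD : FrdICatStub.{0, 0, 0} (InitialThetaData.badGroupDatumOfDoubleUnderline w p hw dGL hS2 C ι).Dv}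
  (Fr : TemperedFrobenioid T' (InitialThetaData.badGroupDatumOfDoubleUnderline w p hw dGL hS2 C ι).Dv VD)

/-- Bookkeeping AT THE GENUINE DATUM: for initial Θ-data `D`, `v̲ = w ∣ v ∈ V(F)^bad`, the [EtTh] §1 objects
`(S, dGL, hS2, ES, C)` with junction `ι`, an [EtTh] Def 3.6 tempered Frobenioid `Fr` on `𝒟_v̲ = CosetCat Π^tp_{X̲̲}` and ANY
remaining tempered-side input `R`, the bad component `𝒞_v̲` of abc-iut-L5-t2's genuine [IUTchI] Ex 3.2 assembly
`D.badLocalFrobenioidAtDoubleUnderline hv w p hw dGL hS2 C ι R.toInput` IS `Fr^{bs-fld}` and its structure functor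
`𝒞_v̲ → ℱ̲_v̲ → 𝒟_v̲` IS the hull's base functor (both `rfl`) — so the theorems below are literally about the bad component
of the `ℱ`-prime-strip datum at `v̲` (Def 5.2 (i)). ([IUTchI] Ex 3.2 (iii) p.71) [claim: Mochizuki2012, status: disputed] -/
theorem badLocalFrobenioidAtDoubleUnderline_Cv_structureFunctor {Fbirat : Type} [Category.{0} Fbirat]
    (R : TemperedThetaRest (GaloisValDatum.ofPlace K p w hw) (InitialThetaData.badGroupDatumOfDoubleUnderline w p hw dGL hS2 C ι)
      (D.qRootAt_not_isUnit hv w p hw) Fr Fbirat) :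
    (D.badLocalFrobenioidAtDoubleUnderline hv w p hw dGL hS2 C ι R.toInput).Cv = Fr.hullCategory ∧
      (D.badLocalFrobenioidAtDoubleUnderline hv w p hw dGL hS2 C ι R.toInput).hull ⋙
          (D.badLocalFrobenioidAtDoubleUnderline hv w p hw dGL hS2 C ι R.toInput).toBase =
        ModelFrobenioid.baseFunctor Fr.bsFldMonoid Fr.cnstFnBsFunctor Fr.divFNatTrans :=
  ⟨rfl, rfl⟩

omit [w.asIdeal.LiesOver v.maximalIdeal.asIdeal] in
/-- **[IUTchI] Cor 5.3 (ii), model case AS PRINTED, AT THE GENUINE BAD PLACE `v̲ ∈ V̲^bad` of the initial Θ-data**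
(`𝒞_v̲ := Fr^{bs-fld}` the base-field-theoretic hull of an [EtTh] Def 3.6 tempered Frobenioid `Fr` on the GENUINE base
`𝒟_v̲ = ℬ^temp(X̲̲_v̲)⁰ = CosetCat Π^tp_{X̲̲}`, `Π^tp_{X̲̲}` the open subgroup of the [EtTh] §1 double-underline curve with
structure morphism to `G_v̲ = Gal(K̄_w/K_w)` through the junction `ι`): «the natural map `Aut(𝒞_v̲) → Aut(𝒟_v̲)` is
bijective» — `CatIsomorphism.DescendBijective` with the §0 natural map's binders DISCHARGED (abc-iut-L5-t4
`hasUnder_baseFunctor_model` / `underUnique_baseFunctor_model` at the hull), TEMPEREDNESS and SLIMNESS of `Π^tp_{X̲̲}`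
being THEOREMS (`BadLocalGroupDatum.isTempered_Huu`, `isSlimGroup_Huu`, abc-iut-L3's bundle `dGL`) and FSMFF-type of
`𝒟_v̲` DISCHARGED — from print's two halves, DISPLAYED: `hker` (injectivity content, the [FrdI] rigidity rows'
conclusion at the hull) and `hlift` (surjectivity, print p. 144 l. 33–39: [AbsTopIII] Prop 3.2 (iv) / Thm 1.9 —
FACT-policy BY NAME), modulo the four [FrdI]
standing hypotheses on `Φ^{bs-fld}` BY NAME.  Binder census: LAW 0 · inputs 2 · by-name 4 (`h`, `hpf`, `hnd`, `hz`).
([IUTchI] Cor 5.3 (ii) p.144) [claim: Mochizuki2012, status: disputed] -/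
theorem genuineBadPlace_hull_descendBijective_of_kernel_trivial_of_lifts
    (h : ModelFrobenioid.Hypotheses Fr.bsFldMonoid Fr.cnstFnBsFunctor)
    (hpf : Objectwise (fun M _ => IsPerfFactorial M) Fr.bsFldMonoid)
    (hnd : IsNonDilatingOn Fr.bsFldMonoid) (hz : ¬ ModelFrobenioid.IsZeroMonoid Fr.bsFldMonoid)
    (hker : ∀ Ψ : Fr.hullCategory ≌ Fr.hullCategory,
      Nonempty (CatIsomorphism.LiesUnder
        (ModelFrobenioid.baseFunctor Fr.bsFldMonoid Fr.cnstFnBsFunctor Fr.divFNatTrans)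
        (ModelFrobenioid.baseFunctor Fr.bsFldMonoid Fr.cnstFnBsFunctor Fr.divFNatTrans)
        Ψ (CategoryTheory.Equivalence.refl
          (C := (InitialThetaData.badGroupDatumOfDoubleUnderline w p hw dGL hS2 C ι).Dv))) →
      Nonempty (Ψ.functor ≅ 𝟭 Fr.hullCategory))
    (hlift : ∀ Θ : (InitialThetaData.badGroupDatumOfDoubleUnderline w p hw dGL hS2 C ι).Dv ≌
        (InitialThetaData.badGroupDatumOfDoubleUnderline w p hw dGL hS2 C ι).Dv,
      ∃ Ψ : Fr.hullCategory ≌ Fr.hullCategory,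
        Nonempty (CatIsomorphism.LiesUnder
          (ModelFrobenioid.baseFunctor Fr.bsFldMonoid Fr.cnstFnBsFunctor Fr.divFNatTrans)
          (ModelFrobenioid.baseFunctor Fr.bsFldMonoid Fr.cnstFnBsFunctor Fr.divFNatTrans) Ψ Θ)) :
    CatIsomorphism.DescendBijective
      (ModelFrobenioid.baseFunctor Fr.bsFldMonoid Fr.cnstFnBsFunctor Fr.divFNatTrans)
      (ModelFrobenioid.baseFunctor Fr.bsFldMonoid Fr.cnstFnBsFunctor Fr.divFNatTrans)
      (Cor53.hasUnder_baseFunctor_model (DivB := Fr.divFNatTrans) h hpf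
        (CosetCat.isSlim_of_isSlimGroup_of_isTempered (BadLocalGroupDatum.isTempered_Huu dGL C)
          (BadLocalGroupDatum.isSlimGroup_Huu dGL C))
        (CosetCat.isOfFSMType (G := ↥C.Huu)).isOfFSMFFType hnd hz)
      (Cor53.underUnique_baseFunctor_model (DivB := Fr.divFNatTrans) h hpf
        (CosetCat.isSlim_of_isSlimGroup_of_isTempered (BadLocalGroupDatum.isTempered_Huu dGL C)
          (BadLocalGroupDatum.isSlimGroup_Huu dGL C))
        (CosetCat.isOfFSMType (G := ↥C.Huu)).isOfFSMFFType hnd hz) :=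
  cosetCat_hull_descendBijective_of_kernel_trivial_of_lifts _ _ Fr (BadLocalGroupDatum.isTempered_Huu dGL C)
    (BadLocalGroupDatum.isSlimGroup_Huu dGL C) h hpf hnd hz hker hlift

omit [w.asIdeal.LiesOver v.maximalIdeal.asIdeal] in
/-- Injectivity half alone AT THE GENUINE BAD PLACE (what the rigidity rows deliver at the hull): `Aut(𝒞_v̲) → Aut(𝒟_v̲)`
is injective as soon as every self-equivalence of `𝒞_v̲` over the identity of `𝒟_v̲` is isomorphic to the identity;
slimness / temperedness / FSMFF-type of the genuine base are theorems. ([IUTchI] Cor 5.3 (ii) p.144) [claim: Mochizuki2012, status: disputed] -/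
theorem genuineBadPlace_hull_descend_injective_of_kernel_trivial
    (h : ModelFrobenioid.Hypotheses Fr.bsFldMonoid Fr.cnstFnBsFunctor)
    (hpf : Objectwise (fun M _ => IsPerfFactorial M) Fr.bsFldMonoid)
    (hnd : IsNonDilatingOn Fr.bsFldMonoid) (hz : ¬ ModelFrobenioid.IsZeroMonoid Fr.bsFldMonoid)
    (hker : ∀ Ψ : Fr.hullCategory ≌ Fr.hullCategory,
      Nonempty (CatIsomorphism.LiesUnder
        (ModelFrobenioid.baseFunctor Fr.bsFldMonoid Fr.cnstFnBsFunctor Fr.divFNatTrans)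
        (ModelFrobenioid.baseFunctor Fr.bsFldMonoid Fr.cnstFnBsFunctor Fr.divFNatTrans)
        Ψ (CategoryTheory.Equivalence.refl
          (C := (InitialThetaData.badGroupDatumOfDoubleUnderline w p hw dGL hS2 C ι).Dv))) →
      Nonempty (Ψ.functor ≅ 𝟭 Fr.hullCategory)) :
    Function.Injective
      (CatIsomorphism.descend
        (Cor53.hasUnder_baseFunctor_model (DivB := Fr.divFNatTrans) h hpf
          (CosetCat.isSlim_of_isSlimGroup_of_isTempered (BadLocalGroupDatum.isTempered_Huu dGL C)
            (BadLocalGroupDatum.isSlimGroup_Huu dGL C))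
          (CosetCat.isOfFSMType (G := ↥C.Huu)).isOfFSMFFType hnd hz)
        (Cor53.underUnique_baseFunctor_model (DivB := Fr.divFNatTrans) h hpf
          (CosetCat.isSlim_of_isSlimGroup_of_isTempered (BadLocalGroupDatum.isTempered_Huu dGL C)
            (BadLocalGroupDatum.isSlimGroup_Huu dGL C))
          (CosetCat.isOfFSMType (G := ↥C.Huu)).isOfFSMFFType hnd hz)) :=
  cosetCat_hull_descend_injective_of_kernel_trivial _ _ Fr (BadLocalGroupDatum.isTempered_Huu dGL C)
    (BadLocalGroupDatum.isSlimGroup_Huu dGL C) h hpf hnd hz hker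

omit [w.asIdeal.LiesOver v.maximalIdeal.asIdeal] in
/-- The «natural homomorphism» form AT THE GENUINE BAD PLACE: `CatIsomorphism.descendHom : Aut(𝒞_v̲) →* Aut(𝒟_v̲)` is
bijective modulo `hker`, `hlift` and the four standing hypotheses on `Φ^{bs-fld}`.
([IUTchI] Cor 5.3 (ii) p.144) [claim: Mochizuki2012, status: disputed] -/
theorem genuineBadPlace_hull_descendHom_bijective_of_kernel_trivial_of_lifts
    (h : ModelFrobenioid.Hypotheses Fr.bsFldMonoid Fr.cnstFnBsFunctor)
    (hpf : Objectwise (fun M _ => IsPerfFactorial M) Fr.bsFldMonoid)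
    (hnd : IsNonDilatingOn Fr.bsFldMonoid) (hz : ¬ ModelFrobenioid.IsZeroMonoid Fr.bsFldMonoid)
    (hker : ∀ Ψ : Fr.hullCategory ≌ Fr.hullCategory,
      Nonempty (CatIsomorphism.LiesUnder
        (ModelFrobenioid.baseFunctor Fr.bsFldMonoid Fr.cnstFnBsFunctor Fr.divFNatTrans)
        (ModelFrobenioid.baseFunctor Fr.bsFldMonoid Fr.cnstFnBsFunctor Fr.divFNatTrans)
        Ψ (CategoryTheory.Equivalence.refl
          (C := (InitialThetaData.badGroupDatumOfDoubleUnderline w p hw dGL hS2 C ι).Dv))) →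
      Nonempty (Ψ.functor ≅ 𝟭 Fr.hullCategory))
    (hlift : ∀ Θ : (InitialThetaData.badGroupDatumOfDoubleUnderline w p hw dGL hS2 C ι).Dv ≌
        (InitialThetaData.badGroupDatumOfDoubleUnderline w p hw dGL hS2 C ι).Dv,
      ∃ Ψ : Fr.hullCategory ≌ Fr.hullCategory,
        Nonempty (CatIsomorphism.LiesUnder
          (ModelFrobenioid.baseFunctor Fr.bsFldMonoid Fr.cnstFnBsFunctor Fr.divFNatTrans)
          (ModelFrobenioid.baseFunctor Fr.bsFldMonoid Fr.cnstFnBsFunctor Fr.divFNatTrans) Ψ Θ)) :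
    Function.Bijective
      (CatIsomorphism.descendHom
        (Cor53.hasUnder_baseFunctor_model (DivB := Fr.divFNatTrans) h hpf
          (CosetCat.isSlim_of_isSlimGroup_of_isTempered (BadLocalGroupDatum.isTempered_Huu dGL C)
            (BadLocalGroupDatum.isSlimGroup_Huu dGL C))
          (CosetCat.isOfFSMType (G := ↥C.Huu)).isOfFSMFFType hnd hz)
        (Cor53.underUnique_baseFunctor_model (DivB := Fr.divFNatTrans) h hpf
          (CosetCat.isSlim_of_isSlimGroup_of_isTempered (BadLocalGroupDatum.isTempered_Huu dGL C)
            (BadLocalGroupDatum.isSlimGroup_Huu dGL C))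
          (CosetCat.isOfFSMType (G := ↥C.Huu)).isOfFSMFFType hnd hz)) :=
  (CatIsomorphism.descendHom_bijective_iff _ _).mpr
    (genuineBadPlace_hull_descendBijective_of_kernel_trivial_of_lifts w p hw dGL hS2 C ι Fr h hpf hnd hz hker hlift)

end GenuineBadPlace

end Cor53

end Literature.IUT.HodgeTheaters

end
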